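import Summits.QuantumFields.BalabanUV.T4Continuum.Support.SubstrateSlotsOfRecord
import Summits.QuantumFields.BalabanUV.T4Continuum.Support.SubstrateChartRelatedPair
import Summits.QuantumFields.BalabanUV.T4Continuum.Support.B13ReadingsDecay

/-!
# SUBSTRATE — THE COV-SHIFTED `Slots` OF RECORD (W-21; NE5 owner RULINGS R53 ∕ R54, `HOME/CLAIMS.log` l.19772 ∕ l.19952; located typing point
# F-ne5p1-g37-1; typer Q-S18): run B's covariance slot at ALIGNED index `k` reads run B's tower of record ONE LEVEL DEEPER,
# `covAtOfRecord (P (K+1)) … U (k+1)` — the W1 readings of record (`B13ReadingsDecay.ReadsTowerCovB`: level `k + 1` of the same member) are then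
# jointly inhabited with run A's reading by the substrate's own one-datum tower (W-20 `covAtOfRecord_carriers_transport`), instead of forcing a
# level-constant tower as the same-level slots of `slotsOfRecord` do

Cell `pub-balaban`, SUBSTRATE cell, seat `b2b-balaban-substrate-p1` (gen 5; author lineage of `rawBOfRecord` p219509 ∕ `slotsOfRecord` p220104 ∕
`SubstrateO1Readings` p225064).  Summits-side under the LEAN PLACEMENT RULE.  APPEND-ONLY BY ADDITION: `SubstrateRawSpecies.rawBOfRecord` and
`SubstrateSlotsOfRecord.slotsOfRecord` stay byte-identical for their accepted consumers; this module adds the shifted successor next to them.  BY NAME: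
`rawOfGreen`, `covAtOfRecord(_of_lt)`, `rawAOfRecord`, `lastCouplingOnly_rawAOfRecord`, `slotsOfRecord` (+ its `rfl` views), `insDatumOfRecord`,
`lastCouplingOnly_insOpB`, `U3PolymerDictionaryNE9Face.factorises_outB_KP_of_lastCoupling`, W-20 `covAtOfRecord_carriers_transport`, the owner's reading
SHAPES `B13ReadingsDecay.ReadsTowerCovA ∕ ReadsTowerCovB` (hypothesis shapes, nothing of the row asserted).

RIDER OF RECORD (R54 (1), verbatim in substance).  Slot index = ALIGNED index `k` (run A's step `k` ↔ run B's own step `k + 1`); run B's extra depth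
enters through (i) the pre-shifted coupling sequence `gBre` (D-6′, `SubstrateTwoRunsDriven` l.168 — unchanged: index `k` reads `g (k − 1)`), (ii) every
TOWER-READ species reading the one-datum tower at depth `k + 1` (today: `.cov` ∕ the Green inside it; any table a later dictionary item hard-wires to a
tower image — Δ ∕ Γ per `B13ReadingsImage`, or a Green-built pot reading — is wired at depth `k + 1` likewise: R54's (γ), applied when a table stops being
free), (iii) free tables (`dkB gcB pQB pRB`, `L.ins.iopB`) instantiated at run B's own step by the instancer.  (β) «whole-record shift» is REJECTED (R54: it
double-shifts the coupling against `gBre` and breaks D-6′).  O-8-vol (R54 (3)): the block torus at every depth := the final unit torus `(2L^m)^d`; print's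
creation torus is larger by `L^{(K−j)d}`; the printed bounds consumed are volume-uniform; no identification of objects across volumes is claimed.

HONEST FRAMING: rung (B)+1 of the FINITE-VOLUME T⁴ programme — NOT infinite volume, NOT a mass gap, NOT Clay; spine PROVED 0∕9; NE5 NOT PRINTED ∕ NOT
proved.  DATA + `rfl`-level bookkeeping, 0 estimate; W1-cov of record = rows NE2 ∧ NE3's TWO-LEVEL tower rate at the related background (R53 (3)),
asserted by nobody here.  LOCATED on the way (§3, for the owner): the reading shape `ReadsTowerCovA` is quantified over ALL `k : ℕ`, and run A's record
reads `0` above its top level `K` (`covAtOfRecord_of_lt`), so at `k = K + 1` the shape forces the read diagonal of the tower member's level-`(K+1)`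
kernel to vanish (`tower_apply_eq_zero_of_readsTowerCovA_top`) — a guard `k ≤ K` (run A's steps; NE5's `C.scale X ≤ K`) is what the instance can
inhabit (`readsTowerCovA_record_of_le`).  HONEST DEPENDENCY (cell line, verbatim): continuum YM on T⁴ ⇐ BetaPertH ∧ nine spine estimates (0/9 proved);
BetaPertH ⇐ (D1) ∧ (D4) ∧ CAP+tail; G-an2-4 gates asym, D1 and NE2/3/4.

WHAT.
* §1 `rawBOfRecordShift` (run B's raw record with `.cov := covAtOfRecord (P (K+1)) ι D.avB c a s Γ U (k+1)`, all other components = `rawBOfRecord`'s),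
  `rfl` views, `lastCouplingOnly_rawBOfRecordShift`, **`rawBOfRecordShift_cov_eq_transport`** (`k + 1 ≤ K`: = run A's covariance OF RECORD at the
  transported background at level `k + 1` — the substrate's `ReadsCovAtB` line, by W-20 §4), `rawBOfRecordShift_cov_top` ∕ `rawAOfRecord_cov_transport_top`
  (at `k = K`: run B's top-level species vs run A's `0` one level above its top — run B's unpartnered depth, read by `gBre`'s pairing, R52).
* §2 `slotsOfRecordShift` (= `slotsOfRecord` with `rawB := (rawBOfRecordShift …).kernel`), `rfl` views, `lastCouplingOnly_slotsShift_rawB ∕ _rawA ∕ _insOpB`,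
  `slotsShift_hraw ∕ _hiop`, `factorises_outB_KP_slotsOfRecordShift` (NE9's D-6 face, as for the unshifted slots).
* §3 THE READINGS OF RECORD AT THE SHIFTED SLOTS (R54 (2) ∕ (ν1)(b)): `rawAOfRecord_cov_transport_of_le` (run A = run B's family at depth `k ≤ K`),
  `cov_aligned_junk` (both `0` above `K`, one threshold), `readsCovAtB_rawBOfRecordShift` (§1; the substrate's shape, `rfl`); with the step-blind datum `tow k g U := U`, `σ t := id` and the substrate's run-B tower
  `c U k := Matrix.of (covAtOfRecord (P (K+1)) … U.1 k () · ·)`: **`readsTowerCovB_shift`** (ALL `k`, `rfl`), **`readsTowerCovA_record_of_le`** (`k ≤ K`,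
  W-20 §4), `tower_apply_eq_zero_of_readsTowerCovA_top` (the located guard point).  The O1 END twin at the shifted slots is the follower W-21b.
-/

noncomputable section

open scoped BigOperators

namespace Summit.QuantumFields.BalabanUV.T4Continuum.SubstrateSlotsOfRecordShift

open Literature.MathematicalPhysics.QuantumFieldTheory.Balaban1983to89
open Literature.MathematicalPhysics.QuantumFieldTheory.Balaban1983to89.T4Continuum (T4Family)
open Literature.MathematicalPhysics.QuantumFieldTheory.Balaban1983to89.T4HistoryLipschitzOuter (Factorises)
open Literature.MathematicalPhysics.QuantumFieldTheory.Balaban1983to89.B5Prop11Plancherel (Tor fine)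
open Literature.MathematicalPhysics.QuantumFieldTheory.Balaban1983to89.B5G183RateUnitTower (lev)
open Summit.QuantumFields.BalabanUV.T4Continuum
open Summit.QuantumFields.BalabanUV.T4Continuum.CovariantBlockAveraging (ContourSystem)
open Summit.QuantumFields.BalabanUV.T4Continuum.B13Carriers (TwoRuns TwoRuns.carriers_transport_val)
open Summit.QuantumFields.BalabanUV.T4Continuum.B13CarriersCubeChart (cubeChart)
open Summit.QuantumFields.BalabanUV.T4Continuum.B13OpDatum (Format Species RawSpecies OpDatum B13Weights)
open Summit.QuantumFields.BalabanUV.T4Continuum.B13HistMeasurable (MeasPotFrame B13HistM)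
open Summit.QuantumFields.BalabanUV.T4Continuum.B13HistInsertion (InsDatum)
open Summit.QuantumFields.BalabanUV.T4Continuum.B13StepTermLabels (InnerLabel)
open Summit.QuantumFields.BalabanUV.T4Continuum.B13InnerData (Bnd)
open Summit.QuantumFields.BalabanUV.T4Continuum.B13StepOfRecord (Slots)
open Summit.QuantumFields.BalabanUV.T4Continuum.B13KPStepOfRecord (outB_KP)
open Summit.QuantumFields.BalabanUV.T4Continuum.B13ReadingsDecay (ReadsTowerCovA ReadsTowerCovB)
open Summit.QuantumFields.BalabanUV.T4Continuum.U3PolymerDictionaryNE9Face (actNE9 oRecLast iRecLast factorises_outB_KP_of_lastCoupling)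
open Summit.QuantumFields.BalabanUV.T4Continuum.SubstrateBackgroundTransporters (unitMod)
open Summit.QuantumFields.BalabanUV.T4Continuum.SubstrateTwoRunsDriven (DrivenRuns)
open Summit.QuantumFields.BalabanUV.T4Continuum.SubstrateRawSpecies
open Summit.QuantumFields.BalabanUV.T4Continuum.SubstrateSlotsOfRecord
open Summit.QuantumFields.BalabanUV.T4Continuum.SubstrateChartRelatedPair (covAtOfRecord_carriers_transport)

variable {G : Type} [GaugeGroup G] (D : DrivenRuns G)

/-! ## §1 Run B's cov-shifted raw record -/

section Raw

variable {o : Type} [Fintype o] [DecidableEq o] (ι : G →* Matrix o o ℂ) (c : ℂ) (a : ℝ) (s : ℕ → ℂ) {T ι' Ω 𝒴 : Type*}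
variable (Γ : (k : ℕ) → ContourSystem (D.F.P (D.K + 1)).d (lev (D.F.P (D.K + 1)).L k) (unitMod (D.F.P (D.K + 1))))
  (dk : GaugeField (D.F.P (D.K + 1)) 0 G → ℕ → T → ι' → ι' → ℂ)
  (gc : GaugeField (D.F.P (D.K + 1)) 0 G → ℕ → T → ((Tor (unitMod (D.F.P (D.K + 1))) × Fin (D.F.P (D.K + 1)).d) × o) → ι' → ℂ)
  (pQ : ℝ → GaugeField (D.F.P (D.K + 1)) 0 G → ℕ → Ω → 𝒴 → ((Tor (unitMod (D.F.P (D.K + 1))) × Fin (D.F.P (D.K + 1)).d) × o) →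
    ((Tor (unitMod (D.F.P (D.K + 1))) × Fin (D.F.P (D.K + 1)).d) × o) → ℂ)
  (pR : ℝ → GaugeField (D.F.P (D.K + 1)) 0 G → ℕ → Ω → 𝒴 → ℂ)

/-- [folklore] **RUN B's COV-SHIFTED RAW RECORD** (R54 (1) (α)): at aligned index `k` the covariance species reads run B's tower of record ONE LEVEL DEEPER,
`covAtOfRecord (P (K+1)) ι D.avB c a s Γ U (k + 1)` (fine lattice = depth `k + 1`, background `M^{K−k} U` — one level finer than run A's `M^{K−k}(transport U)`
at depth `k`); the kernel ∕ potential TABLES and the D-6′ coupling read `g (k − 1)` are `rawBOfRecord`'s, unchanged. -/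
def rawBOfRecordShift : (ℕ → ℝ) → D.carriers.BgB → ℕ → RawSpecies T ((Tor (unitMod (D.F.P (D.K + 1))) × Fin (D.F.P (D.K + 1)).d) × o) ι' Ω 𝒴 :=
  fun g U k => rawOfGreen (fun _ U' k' => covAtOfRecord (D.F.P (D.K + 1)) ι D.avB c a s Γ U' (k' + 1)) (fun _ U' k' => dk U' k') (fun _ U' k' => gc U' k')
    (fun g' U' k' => pQ (g' (k' - 1)) U' k') (fun g' U' k' => pR (g' (k' - 1)) U' k') g U.1 k

/-- [folklore] The shifted covariance slot, unfolded (`rfl`). -/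
@[simp] theorem rawBOfRecordShift_cov (g : ℕ → ℝ) (U : D.carriers.BgB) (k : ℕ) (t : T)
    (b b' : (Tor (unitMod (D.F.P (D.K + 1))) × Fin (D.F.P (D.K + 1)).d) × o) :
    (rawBOfRecordShift D ι c a s Γ dk gc pQ pR g U k).cov t b b' = covAtOfRecord (D.F.P (D.K + 1)) ι D.avB c a s Γ U.1 (k + 1) t b b' := rfl

/-- [folklore] The Δ-kernel table is `rawBOfRecord`'s (`rfl`). -/
theorem rawBOfRecordShift_deltaKer (g : ℕ → ℝ) (U : D.carriers.BgB) (k : ℕ) :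
    (rawBOfRecordShift D ι c a s Γ dk gc pQ pR g U k).deltaKer = (rawBOfRecord ι D c a s Γ dk gc pQ pR g U k).deltaKer := rfl

/-- [folklore] The Γ-constituent table is `rawBOfRecord`'s (`rfl`). -/
theorem rawBOfRecordShift_gammaConstituent (g : ℕ → ℝ) (U : D.carriers.BgB) (k : ℕ) :
    (rawBOfRecordShift D ι c a s Γ dk gc pQ pR g U k).gammaConstituent = (rawBOfRecord ι D c a s Γ dk gc pQ pR g U k).gammaConstituent := rfl

/-- [folklore] The pot-`Q` table is `rawBOfRecord`'s (last coupling `g (k − 1)`; `rfl`). -/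
theorem rawBOfRecordShift_potQ (g : ℕ → ℝ) (U : D.carriers.BgB) (k : ℕ) :
    (rawBOfRecordShift D ι c a s Γ dk gc pQ pR g U k).potQ = (rawBOfRecord ι D c a s Γ dk gc pQ pR g U k).potQ := rfl

/-- [folklore] The pot-`R` table is `rawBOfRecord`'s (`rfl`). -/
theorem rawBOfRecordShift_potR (g : ℕ → ℝ) (U : D.carriers.BgB) (k : ℕ) :
    (rawBOfRecordShift D ι c a s Γ dk gc pQ pR g U k).potR = (rawBOfRecord ι D c a s Γ dk gc pQ pR g U k).potR := rfl

/-- [folklore] **D-6 FOR THE SHIFTED RECORD, BY CONSTRUCTION** (the coupling read is unchanged: index `k + 1` reads only `g k`). -/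
theorem lastCouplingOnly_rawBOfRecordShift : LastCouplingOnly (rawBOfRecordShift D ι c a s Γ dk gc pQ pR) := by
  intro g g' U k hg
  simp only [rawBOfRecordShift, rawOfGreen, Nat.add_sub_cancel, hg]

/-- [folklore] **THE SHIFTED SLOT READS RUN A's COVARIANCE OF RECORD AT THE TRANSPORTED BACKGROUND, ONE LEVEL DEEPER** (`k + 1 ≤ K`; the substrate's
`SubstrateRawSpecies.ReadsCovAtB` line at the common letters `(c, a, s, Γ)`, by W-20 `covAtOfRecord_carriers_transport`). -/
theorem rawBOfRecordShift_cov_eq_transport (g : ℕ → ℝ) (U : D.carriers.BgB) {k : ℕ} (hk : k + 1 ≤ D.K) (t : T)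
    (b b' : (Tor (unitMod (D.F.P (D.K + 1))) × Fin (D.F.P (D.K + 1)).d) × o) :
    (rawBOfRecordShift D ι c a s Γ dk gc pQ pR g U k).cov t b b' =
      covAtOfRecord (D.F.P D.K) ι D.avA c a s Γ (D.carriers.transport U).1 (k + 1) t b b' := by
  rw [rawBOfRecordShift_cov, covAtOfRecord_carriers_transport D ι c a s Γ U hk t b b']

/-- [folklore] **AT RUN A's TOP INDEX `k = K` THE SHIFTED SLOT IS RUN B's TOP-LEVEL SPECIES** (depth `K + 1`, run B's unpartnered depth — `rfl`) … -/
theorem rawBOfRecordShift_cov_top (g : ℕ → ℝ) (U : D.carriers.BgB) (t : T) (b b' : (Tor (unitMod (D.F.P (D.K + 1))) × Fin (D.F.P (D.K + 1)).d) × o) :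
    (rawBOfRecordShift D ι c a s Γ dk gc pQ pR g U D.K).cov t b b' = covAtOfRecord (D.F.P (D.K + 1)) ι D.avB c a s Γ U.1 (D.K + 1) t b b' := rfl

/-- [folklore] **THE JUNK REGION IS ALIGNED** ((ν1)(b)(ii)): above run A's top index the SHIFTED run-B slot reads `0` too (`covAtOfRecord_of_lt` at
`(P (K+1)).K = K + 1 < k + 1`) — ONE threshold `D.K < k` for both runs (unshifted, run B's aligned index `K + 1` was its REAL top step against run A's `0`). -/
theorem rawBOfRecordShift_cov_of_lt (g : ℕ → ℝ) (U : D.carriers.BgB) {k : ℕ} (hk : D.K < k) (t : T)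
    (b b' : (Tor (unitMod (D.F.P (D.K + 1))) × Fin (D.F.P (D.K + 1)).d) × o) :
    (rawBOfRecordShift D ι c a s Γ dk gc pQ pR g U k).cov t b b' = 0 :=
  covAtOfRecord_of_lt (P := D.F.P (D.K + 1)) (ι := ι) (av := D.avB) (c := c) (a := a) (s := s) (Γ := Γ) _
    (show (D.F.P (D.K + 1)).K < k + 1 from Nat.succ_lt_succ hk) t b b'

/-- [folklore] … while run A's covariance of record one level above ITS top reads `0` (`covAtOfRecord_of_lt`). -/
theorem covAtOfRecord_transport_above_top (U : D.carriers.BgB) {k : ℕ} (hk : D.K < k) (t : T)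
    (b b' : (Tor (unitMod (D.F.P (D.K + 1))) × Fin (D.F.P (D.K + 1)).d) × o) :
    covAtOfRecord (D.F.P D.K) ι D.avA c a s Γ (D.carriers.transport U).1 k t b b' = 0 :=
  covAtOfRecord_of_lt (P := D.F.P D.K) (ι := ι) (av := D.avA) (c := c) (a := a) (s := s) (Γ := Γ) _ (show (D.F.P D.K).K < k from hk) t b b'

/-- [folklore] **THE SUBSTRATE's `ReadsCovAtB` SHAPE INSTANTIATED AT LAST** ((ν1)(b)(iii); the gen-1 sketch §RAW shape, `tr := id`): the shifted record reads run B's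
OWN covariance family of record one level deeper — ALL indices, `rfl`.  (Against run A's family through the transporter only the GUARDED
`rawBOfRecordShift_cov_eq_transport`, `k + 1 ≤ K`.) -/
theorem readsCovAtB_rawBOfRecordShift (W : Set (ℕ → ℝ)) :
    ReadsCovAtB (fun U : D.carriers.BgB => U) (fun _ (U : D.carriers.BgB) k => covAtOfRecord (D.F.P (D.K + 1)) ι D.avB c a s Γ U.1 k)
      (rawBOfRecordShift D ι c a s Γ dk gc pQ pR) W :=
  fun _ _ _ _ _ _ _ => rfl

end Raw

/-! ## §2 The cov-shifted `Slots` of record -/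

section SlotsShift

variable {o : Type} [Fintype o] [DecidableEq o] (ι : G →* Matrix o o ℂ) (c : ℂ) (a : ℝ) (s : ℕ → ℂ)
variable {T ι' S Ω 𝒴 : Type} (P : MeasPotFrame D.carriers) {IOp : Type*}
  (𝒵 : D.carriers.Dom → InnerLabel D.carriers.Dom (Bnd D.toTwoRuns) → Type) [∀ Z j, Fintype (𝒵 Z j)] (dom : ∀ Z j, 𝒵 Z j → D.carriers.Dom)
  (Jc : D.carriers.Dom → InnerLabel D.carriers.Dom (Bnd D.toTwoRuns) → Type) [∀ Z j, Fintype (Jc Z j)]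
  (V : D.carriers.Dom → InnerLabel D.carriers.Dom (Bnd D.toTwoRuns) → Type) [∀ Z j, NormedAddCommGroup (V Z j)]
  [∀ Z j, InnerProductSpace ℝ (V Z j)] [∀ Z j, MeasurableSpace (V Z j)] [∀ Z j, BorelSpace (V Z j)] [∀ Z j, FiniteDimensional ℝ (V Z j)]
  (mI : D.carriers.Dom → InnerLabel D.carriers.Dom (Bnd D.toTwoRuns) → Type) [∀ Z j, Fintype (mI Z j)] [∀ Z j, DecidableEq (mI Z j)]
  (L : SlotLetters D (o := o) (T := T) (ι' := ι') (S := S) (Ω := Ω) (𝒴 := 𝒴) P (IOp := IOp) 𝒵 dom Jc V mI)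

/-- [folklore] **THE COV-SHIFTED `Slots` OF RECORD**: `slotsOfRecord` with run B's raw species replaced by the kernel of `rawBOfRecordShift` — `act`, `F`, `rawA`,
the insertion datum and the margins UNCHANGED. -/
def slotsOfRecordShift : Slots D.toTwoRuns (SpeciesRec D o T ι' Ω 𝒴) IOp (B13HistM P) :=
  { slotsOfRecord D ι c a s P 𝒵 dom Jc V mI L with
    rawB := fun g U k => (rawBOfRecordShift D ι c a s L.ΓB L.dkB L.gcB L.pQB L.pRB g U k).kernel }

/-- [folklore] `act` is `slotsOfRecord`'s (`rfl`). -/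
theorem slotsOfRecordShift_act : (slotsOfRecordShift D ι c a s P 𝒵 dom Jc V mI L).act = (slotsOfRecord D ι c a s P 𝒵 dom Jc V mI L).act := rfl

/-- [folklore] The formats are `slotsOfRecord`'s: `(L.W k).format` (`rfl`). -/
theorem slotsOfRecordShift_F (k : ℕ) : (slotsOfRecordShift D ι c a s P 𝒵 dom Jc V mI L).F k = (L.W k).format := rfl

/-- [folklore] Run A's raw species slot is `slotsOfRecord`'s: the kernel of `rawAOfRecord` (`rfl`). -/
theorem slotsOfRecordShift_rawA (g : ℕ → ℝ) (U : D.carriers.BgA) (k : ℕ) : (slotsOfRecordShift D ι c a s P 𝒵 dom Jc V mI L).rawA g U k =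
    (rawAOfRecord ι D c a s L.ΓA L.dkA L.gcA L.pQA L.pRA g U k).kernel := rfl

/-- [folklore] **Run B's raw species slot IS the kernel of the SHIFTED record** (`rfl`). -/
theorem slotsOfRecordShift_rawB (g : ℕ → ℝ) (U : D.carriers.BgB) (k : ℕ) : (slotsOfRecordShift D ι c a s P 𝒵 dom Jc V mI L).rawB g U k =
    (rawBOfRecordShift D ι c a s L.ΓB L.dkB L.gcB L.pQB L.pRB g U k).kernel := rfl

/-- [folklore] The insertion datum is `insDatumOfRecord` (`rfl`). -/
theorem slotsOfRecordShift_D : (slotsOfRecordShift D ι c a s P 𝒵 dom Jc V mI L).D = insDatumOfRecord D L.ins := rfl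

/-- [folklore] The margins are `slotsOfRecord`'s (`rfl`). -/
theorem slotsOfRecordShift_rOp : (slotsOfRecordShift D ι c a s P 𝒵 dom Jc V mI L).rOp = L.rOp := rfl

/-- [folklore] D-6 for the shifted slots, run B (`lastCouplingOnly_rawBOfRecordShift`). -/
theorem lastCouplingOnly_slotsShift_rawB : LastCouplingOnly (slotsOfRecordShift D ι c a s P 𝒵 dom Jc V mI L).rawB := by
  intro g g' U k hg
  rw [slotsOfRecordShift_rawB, slotsOfRecordShift_rawB, lastCouplingOnly_rawBOfRecordShift D ι c a s L.ΓB L.dkB L.gcB L.pQB L.pRB g g' U k hg]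

/-- [folklore] D-6 for the shifted slots, run A (unchanged slot). -/
theorem lastCouplingOnly_slotsShift_rawA : LastCouplingOnly (slotsOfRecordShift D ι c a s P 𝒵 dom Jc V mI L).rawA :=
  lastCouplingOnly_slots_rawA D ι c a s P 𝒵 dom Jc V mI L

/-- [folklore] D-6′ for the shifted slots' insertion operator (unchanged datum). -/
theorem lastCouplingOnly_slotsShift_insOpB : LastCouplingOnly (slotsOfRecordShift D ι c a s P 𝒵 dom Jc V mI L).D.insOpB :=
  lastCouplingOnly_insOpB D L.ins

/-- [folklore] The `hraw` hypothesis of NE9's D-6 face, for the shifted slots. -/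
theorem slotsShift_hraw : ∀ (g g' : ℕ → ℝ) (U : D.carriers.BgB) (k : ℕ), g k = g' k →
    (slotsOfRecordShift D ι c a s P 𝒵 dom Jc V mI L).rawB g U (k + 1) = (slotsOfRecordShift D ι c a s P 𝒵 dom Jc V mI L).rawB g' U (k + 1) :=
  lastCouplingOnly_slotsShift_rawB D ι c a s P 𝒵 dom Jc V mI L

/-- [folklore] The `hiop` hypothesis of NE9's D-6 face, for the shifted slots. -/
theorem slotsShift_hiop : ∀ (g g' : ℕ → ℝ) (U : D.carriers.BgB) (k : ℕ), g k = g' k →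
    (slotsOfRecordShift D ι c a s P 𝒵 dom Jc V mI L).D.insOpB g U (k + 1) = (slotsOfRecordShift D ι c a s P 𝒵 dom Jc V mI L).D.insOpB g' U (k + 1) :=
  lastCouplingOnly_slotsShift_insOpB D ι c a s P 𝒵 dom Jc V mI L

/-- [folklore] **NE9's D-6 FACE AT THE SHIFTED SLOTS** (`factorises_outB_KP_of_lastCoupling` on the two last-coupling lines, exactly as for `slotsOfRecord`). -/
theorem factorises_outB_KP_slotsOfRecordShift (E₀ cB : ℝ) (W : Set (ℕ → ℝ)) :
    Factorises (C := D.carriers) (ι := D.carriers.BgB × D.carriers.Dom) (outB_KP (slotsOfRecordShift D ι c a s P 𝒵 dom Jc V mI L) E₀ cB) W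
      (fun _ _ H p => H p.1 p.2)
      fun k σ Q U X => ((cubeChart D.toTwoRuns).geom.newTerm
        (actNE9 (slotsOfRecordShift D ι c a s P 𝒵 dom Jc V mI L) (oRecLast (slotsOfRecordShift D ι c a s P 𝒵 dom Jc V mI L))
          (iRecLast (slotsOfRecordShift D ι c a s P 𝒵 dom Jc V mI L)))
        k σ U X (fun Y => Q (U, Y))).re :=
  factorises_outB_KP_of_lastCoupling _ E₀ cB W (slotsShift_hraw D ι c a s P 𝒵 dom Jc V mI L) (slotsShift_hiop D ι c a s P 𝒵 dom Jc V mI L)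

end SlotsShift

/-! ## §3 The W1 readings of record at the shifted slots (R54 (2)) -/

section Readings

variable {o : Type} [Fintype o] [DecidableEq o] (ι : G →* Matrix o o ℂ) (c : ℂ) (a : ℝ) (s : ℕ → ℂ) {T ι' Ω 𝒴 : Type*}
variable (Γ : (k : ℕ) → ContourSystem (D.F.P (D.K + 1)).d (lev (D.F.P (D.K + 1)).L k) (unitMod (D.F.P (D.K + 1))))
  (dkA : GaugeField (D.F.P D.K) 0 G → ℕ → T → ι' → ι' → ℂ)
  (gcA : GaugeField (D.F.P D.K) 0 G → ℕ → T → ((Tor (unitMod (D.F.P D.K)) × Fin (D.F.P D.K).d) × o) → ι' → ℂ)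
  (pQA : ℝ → GaugeField (D.F.P D.K) 0 G → ℕ → Ω → 𝒴 → ((Tor (unitMod (D.F.P D.K)) × Fin (D.F.P D.K).d) × o) →
    ((Tor (unitMod (D.F.P D.K)) × Fin (D.F.P D.K).d) × o) → ℂ)
  (pRA : ℝ → GaugeField (D.F.P D.K) 0 G → ℕ → Ω → 𝒴 → ℂ)
  (dkB : GaugeField (D.F.P (D.K + 1)) 0 G → ℕ → T → ι' → ι' → ℂ)
  (gcB : GaugeField (D.F.P (D.K + 1)) 0 G → ℕ → T → ((Tor (unitMod (D.F.P (D.K + 1))) × Fin (D.F.P (D.K + 1)).d) × o) → ι' → ℂ)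
  (pQB : ℝ → GaugeField (D.F.P (D.K + 1)) 0 G → ℕ → Ω → 𝒴 → ((Tor (unitMod (D.F.P (D.K + 1))) × Fin (D.F.P (D.K + 1)).d) × o) →
    ((Tor (unitMod (D.F.P (D.K + 1))) × Fin (D.F.P (D.K + 1)).d) × o) → ℂ)
  (pRB : ℝ → GaugeField (D.F.P (D.K + 1)) 0 G → ℕ → Ω → 𝒴 → ℂ)
  (W : Set (ℕ → ℝ))

/-- [folklore] **RUN A's RECORD AT THE TRANSPORTED BACKGROUND = RUN B's FAMILY OF RECORD AT THE SAME DEPTH, ON RUN A's LEVELS `k ≤ K`** ((ν1)(b)(i); W-20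
`covAtOfRecord_carriers_transport` for the `.cov` component of `rawAOfRecord`, common letters `(c, a, s, Γ)`). -/
theorem rawAOfRecord_cov_transport_of_le {k : ℕ} (hk : k ≤ D.K) (g : ℕ → ℝ) (U : D.carriers.BgB) (t : T)
    (b b' : (Tor (unitMod (D.F.P (D.K + 1))) × Fin (D.F.P (D.K + 1)).d) × o) :
    (rawAOfRecord (ι' := ι') (Ω := Ω) (𝒴 := 𝒴) ι D c a s Γ dkA gcA pQA pRA g (D.carriers.transport U) k).cov t b b' =
      covAtOfRecord (D.F.P (D.K + 1)) ι D.avB c a s Γ U.1 k t b b' :=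
  covAtOfRecord_carriers_transport D ι c a s Γ U hk t b b'

/-- [folklore] **BOTH RUNS' COV SLOTS VANISH ABOVE RUN A's TOP, ONE THRESHOLD** ((ν1)(b)(ii)): `D.K < k` ⟹ run A's record at the transported background AND the
shifted run-B record read `0` at aligned index `k`. -/
theorem cov_aligned_junk {k : ℕ} (hk : D.K < k) (g : ℕ → ℝ) (U : D.carriers.BgB) (t : T)
    (b b' : (Tor (unitMod (D.F.P (D.K + 1))) × Fin (D.F.P (D.K + 1)).d) × o) :
    (rawAOfRecord (ι' := ι') (Ω := Ω) (𝒴 := 𝒴) ι D c a s Γ dkA gcA pQA pRA g (D.carriers.transport U) k).cov t b b' = 0 ∧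
      (rawBOfRecordShift (ι' := ι') (Ω := Ω) (𝒴 := 𝒴) D ι c a s Γ dkB gcB pQB pRB g U k).cov t b b' = 0 :=
  ⟨covAtOfRecord_transport_above_top D ι c a s Γ U hk t b b', rawBOfRecordShift_cov_of_lt D ι c a s Γ dkB gcB pQB pRB g U hk t b b'⟩

/-- [folklore] **`ReadsTowerCovB` AT THE SHIFTED SLOT — ALL INDICES, `rfl`**: with the substrate's run-B TOWER OF RECORD as the family
`c U k := Matrix.of (covAtOfRecord (P (K+1)) ι D.avB c a s Γ U.1 k () · ·)`, the STEP-BLIND datum `tow k g U := U` and `σ t := id`, run B's shifted slot at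
index `k` IS the level-`(k+1)` kernel of the member `U`. -/
theorem readsTowerCovB_shift :
    ReadsTowerCovB (J := D.carriers.BgB) (T := T)
      (fun (U : D.carriers.BgB) k => Matrix.of fun p q => covAtOfRecord (D.F.P (D.K + 1)) ι D.avB c a s Γ U.1 k () p q)
      (fun _ => id) (fun _ _ U => U) (rawBOfRecordShift (ι' := ι') (Ω := Ω) (𝒴 := 𝒴) D ι c a s Γ dkB gcB pQB pRB) W :=
  fun _ _ _ _ _ _ _ => rfl

/-- [folklore] **`ReadsTowerCovA`'s LINE AT THE SAME FAMILY AND DATUM, ON RUN A's LEVELS `k ≤ K`**: run A's raw covariance of record at the transported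
background IS the level-`k` kernel of the member `U` (W-20 `covAtOfRecord_carriers_transport`).  The shape's remaining indices `k > K` are NOT inhabitable by
the record — `tower_apply_eq_zero_of_readsTowerCovA_top`. -/
theorem readsTowerCovA_record_of_le {k : ℕ} (hk : k ≤ D.K) (g : ℕ → ℝ) (U : D.carriers.BgB) (t : T)
    (p q : (Tor (unitMod (D.F.P (D.K + 1))) × Fin (D.F.P (D.K + 1)).d) × o) :
    (rawAOfRecord (ι' := ι') (Ω := Ω) (𝒴 := 𝒴) ι D c a s Γ dkA gcA pQA pRA g (D.carriers.transport U) k).cov t p q =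
      (Matrix.of fun p q => covAtOfRecord (D.F.P (D.K + 1)) ι D.avB c a s Γ U.1 k () p q) p q := by
  rw [Matrix.of_apply, ← covAtOfRecord_carriers_transport D ι c a s Γ U hk () p q]
  rfl

/-- [folklore] **LOCATED GUARD POINT**: the shape `ReadsTowerCovA` quantifies ALL `k : ℕ`; since run A's record reads `0` above its top level, ANY inhabitant
`(c, σ, tow)` of `ReadsTowerCovA c σ tow (rawAOfRecord … ∘ transport) W` has the read entries of its member's level-`k` kernel VANISH for every `k > K` — in
particular at run B's top depth `K + 1`.  (So the pair `hcovA ∧ hcovB` of the E1 ENDs is inhabitable by a tower with non-vanishing read diagonal only under a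
guard `k ≤ K` on `ReadsTowerCovA`; the guard is the owner's to place.) -/
theorem tower_apply_eq_zero_of_readsTowerCovA_top {J n : Type*} {cT : J → ℕ → Matrix n n ℂ}
    {σ : T → ((Tor (unitMod (D.F.P D.K)) × Fin (D.F.P D.K).d) × o) → n} {tow : ℕ → (ℕ → ℝ) → D.carriers.BgB → J}
    (h : ReadsTowerCovA cT σ tow (fun g U k => rawAOfRecord (ι' := ι') (Ω := Ω) (𝒴 := 𝒴) ι D c a s Γ dkA gcA pQA pRA g (D.carriers.transport U) k) W)
    {k : ℕ} (hk : D.K < k) {g : ℕ → ℝ} (hg : g ∈ W) (U : D.carriers.BgB) (t : T) (p q : (Tor (unitMod (D.F.P D.K)) × Fin (D.F.P D.K).d) × o) :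
    cT (tow k g U) k (σ t p) (σ t q) = 0 := by
  rw [← h k g hg U t p q]
  exact covAtOfRecord_transport_above_top D ι c a s Γ U hk t p q

end Readings

end Summit.QuantumFields.BalabanUV.T4Continuum.SubstrateSlotsOfRecordShift

end
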